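import Mathlib
import Literature.Computability.AlgebraicComplexity.FSV18Thm48TopFanInHolds
import Literature.Computability.AlgebraicComplexity.ASSS16BaseLevelDepthThree
import Literature.Computability.AlgebraicComplexity.FSV18VandermondeExtraction
import Literature.Computability.AlgebraicComplexity.FSV18OccurDegreeBound
import Literature.Computability.AlgebraicComplexity.ASSS16DepthThreeNumerics
import HarnessLib

/-!
# FSV 2018 Thm. 48 AS PRINTED — unbounded top fan-in, abstract sparse-hitting `Φ` — the named fact
# `FSV2018_thm48` DISCHARGED (val-lit p2 g9)

Forbes–Shpilka–Volk [ForbesShpilkaVolk2018], Thm. 48 (seq.) = ToC Thm. 5.24 (tree: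
`FSV2018_thm48`, `AC/FSV18SuccinctGenerators.lean`): "Suppose `Φ(w) : 𝔽^m → 𝔽^N` is a map such
that for any polynomial `F(X)` of sparsity at most `R!·s^R`, `F ∘ Φ ≢ 0`. Then there exist integers
`r_1, …, r_{D-2} ∈ [R]`, for `R = (2k)^{2D·2^D}` such that the map
`Ψ : X_i ↦ Σ_{ℓ=1}^{D-2} (Σ_{j=1}^{r_ℓ} y_{j,ℓ} t_ℓ^{ij}) + Φ(w)` is a generator for polynomials computed
by depth-`D` occur-`k` formulas of size `s` assuming `char(𝔽) = 0` or `char(𝔽) > s^R`."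
FSV quote this as "(a variant of) a theorem proved by Agrawal et al. [ASSS16]". The printed proof of
[AgrawalEtAl2011] (§4, Thm. dDkrPIT, arXiv:1111.0582 p0009–p0010) builds the faithful map only
after the reduction "by reusing symbols, assume that `C` … has a `+` gate on top having top fanin at
most `k`", a reduction carried out at the level of hitting SETS (`C(x + e_i) - C(x)`), which is not
available for an abstract `Φ`; the tree accordingly held the generator statement only for the
bounded-top-fan-in class (`FSV2018_thm48_topFanIn_holds`, `AC/FSV18Thm48TopFanInHolds.lean`) and kept
`FSV2018_thm48` as a provenance record (val-lit caveat B21).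

This file PROVES THE PRINTED STATEMENT (`FSV2018_thm48_holds : FSV2018_thm48`), by an argument not
in [ASSS16]/FSV:

* (extraction) the first Vandermonde block, through ONE seed, extracts first-order partials:
  `Ψ_0(C) = 0 ⟹ Ψ_1(∂_m C) = 0` for every coefficient variable `x_m`
  (`ASSS16.map_pderiv_eq_zero_of_aeval_vdmBlock_add_eq_zero`, `AC/FSV18VandermondeExtraction.lean`);
* (occur-`k`) for a root `+` gate `C = Σ_u T_u` of ANY fan-in, `∂_m C = Σ_{u : x_m occurs in T_u} ∂_m T_u`
  has at most `k` summands — a LINEAR polynomial in a family of `≤ k` first-order derivatives of the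
  root's children, so it suffices that `Ψ_1` be faithful to such families (Thm. 2.1,
  `ASSS16.map_aeval_ne_zero_of_faithful`); faithfulness to `{T_u}` itself — impossible for fan-in
  `> R`, and the reason for [ASSS16]'s "reusing symbols" — is never needed;
* (levels) that faithfulness is the tree's one-level lemma `thm48_levelInvariant_step` run at
  (depth `D - j`, order `j`, size `r_j = (asssRec k k j).1`), `j = 1, …, D-4`, one block each, down to
* (base at depth 3) `ASSS16.baseLevelDepthThree` (`AC/ASSS16BaseLevelDepthThree.lean`: gcd trick +
  explicit sparsity of the residual Jacobian minor, hit by `Φ` directly) on block `D - 3`;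
  so `1 + (D - 4) + 1 = D - 2` blocks — FSV's count — suffice ([ASSS16]'s own base sits at the
  products-of-sparse-polynomials level; the landed bounded-fan-in proof based one level lower and
  used all `D - 2` blocks there);
* (root) a root `×∧` gate reduces to its children (domain), a root leaf is sparse;
* (numerics / characteristic) every block size is `(asssRec k k j).1 ≤ R` (t21's
  `asssRec_fst_le_asssR_max_of_le_sub_three`), every Jacobian-criterion threshold and the extraction
  threshold `(s+1)^D` is below `s^R` (t21's `char_clause_of_level_sub_three`), and the depth-3
  sparsity budget `r!·((k(c+r)+1)^{c+1} s^{2k(c+r)(c+1)})^r` fits under `R!·s^R`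
  (`ASSS16.baseThree_budget`, from `asssRec_fst_le`: `r ≤ (2k)^{2^D-2}` while `R = ((2k)^{2^D})^{2D}`).
  The TYPED clause `char = 0 ∨ s^R < char` is used as typed (`s ≥ 2`; `s ≤ 1`, `k = 0`, `D = 0` are
  the constant cases).

Theorem-only; no definitions, no named facts; net debt `-1` (`FSV2018_thm48`); the definition at
`FSV18SuccinctGenerators.lean` is untouched. Honest framing: a PIT generator theorem for
bounded-depth bounded-occur formulas (the printed FSV Thm. 48 is TRUE as stated, by a proof that
fills the gap B21 between the print and its cited source); `VP ≠ VNP` is NOT proved and nothing here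
is progress on it. bears_on: V4 (N1 record).

## References
* [ForbesShpilkaVolk2018] M. A. Forbes, A. Shpilka, B. L. Volk, *Succinct hitting sets and barriers to
  proving lower bounds for algebraic circuits*, ToC 14 (2018), arXiv:1701.05328: Def. 45, Constr. 46,
  Thm. 48 (seq.) = ToC Def. 5.21, Constr. 5.22, Thm. 5.24 (locator paper:arxiv-1701.05328
  p0021.txt:L31; paper:doi-10-4086-toc-2018-v014a018 p0030.txt:L6).
* [AgrawalEtAl2011] M. Agrawal, C. Saha, R. Saptharishi, N. Saxena, *Jacobian hits circuits*,
  arXiv:1111.0582 (STOC 2012 / SICOMP 45 (2016)), §2 (Thm. 2.1, Lemma 2.2), §4 (Lemma 4.1, 4.2,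
  Cor. 4.3, Thm. dDkrPIT); locators paper:arxiv-1111.0582 p0009.txt:L3–L34, p0010.txt:L1–L62.
-/

noncomputable section

namespace Literature.Computability.AlgebraicComplexity

open MvPolynomial Finset Literature.Barriers.ValiantsHypothesis

open scoped BigOperators

open Literature.RepresentationTheory.AlgebraicGroups (iterPderiv iterPderiv_zero iterPderiv_single)

/-! ## Part N. Numerics: the depth-3 base fits FSV's budget `R!·s^R`, `R = (2k)^{2D·2^D}` -/

namespace ASSS16

/-- `ρ! · A^ρ ≤ (ρ·A)!` for `A ≥ 1` (the multiples `A, 2A, …, ρA` are among `1, …, ρA`). [folklore] -/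
private theorem factorial_mul_pow_le_factorial_mul (A : ℕ) (hA : 1 ≤ A) :
    ∀ ρ : ℕ, ρ.factorial * A ^ ρ ≤ (ρ * A).factorial
  | 0 => by simp
  | ρ + 1 => by
    have ih := factorial_mul_pow_le_factorial_mul A hA ρ
    have hN : (ρ + 1) * A ≠ 0 := Nat.mul_ne_zero (Nat.succ_ne_zero _) (by omega)
    have hle : ρ * A ≤ (ρ + 1) * A - 1 := by
      rw [Nat.succ_mul]
      omega
    calc (ρ + 1).factorial * A ^ (ρ + 1) = (ρ.factorial * A ^ ρ) * ((ρ + 1) * A) := by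
          rw [Nat.factorial_succ, pow_succ]; ring
      _ ≤ (ρ * A).factorial * ((ρ + 1) * A) := Nat.mul_le_mul_right _ ih
      _ ≤ ((ρ + 1) * A - 1).factorial * ((ρ + 1) * A) :=
          Nat.mul_le_mul_right _ (Nat.factorial_le hle)
      _ = ((ρ + 1) * A).factorial := by rw [mul_comm]; exact Nat.mul_factorial_pred hN

/-- `D + 2 ≤ 2^D` for `D ≥ 2`. [folklore] -/
private theorem add_two_le_two_pow {D : ℕ} (hD : 2 ≤ D) : D + 2 ≤ 2 ^ D := by
  obtain ⟨E, rfl⟩ : ∃ E, D = E + 2 := ⟨D - 2, by omega⟩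
  have h := @Nat.lt_two_pow_self E
  have h4 : 2 ^ (E + 2) = 4 * 2 ^ E := by rw [pow_add]; ring
  omega

/-- **The depth-3 base fits the printed budget.** With `ρ = r_{D-3} = (asssRec k k (D-3)).1`,
`c = D - 3` and `R = asssR k D = (2k)^{2D·2^D}`:
`ρ! · ((k(c+ρ)+1)^{c+1} · s^{2k(c+ρ)(c+1)})^ρ ≤ R! · s^R` (`k, s ≥ 1`, `D ≥ 4`). Route: `ρ ≤ (2k)^{2^D-2}`
(the tree's `asssRec_fst_le`, "it is easy to bound `r_{D-2}` by `R`"), whence `2k(c+ρ) ≤ (2k)^{2^D} =: P`,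
`R = P^{2D}`, `ρ!·A^ρ ≤ (ρA)!` with `ρA ≤ P^{D-1} ≤ R`, and the `s`-exponent `≤ P^3 ≤ R`.
[cite: AgrawalEtAl2011, §4 (Thm. dDkrPIT, proof: "it is easy to bound `r_{D-2}` by `R = (2k)^{2D·2^D}`", "sparsity bounded by `s^R`"); ForbesShpilkaVolk2018, Thm. 48 (seq.) = ToC Thm. 5.24 (`R!·s^R`)]
locator: paper:arxiv-1111.0582 p0010.txt:L40–L55 -/
theorem baseThree_budget {k D s j : ℕ} (hk : 1 ≤ k) (hs : 1 ≤ s) (hjD : j + 3 = D) (hj : 1 ≤ j) :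
    ((asssRec k k j).1).factorial *
        ((k * (j + (asssRec k k j).1) + 1) ^ (j + 1) *
          s ^ (2 * (k * (j + (asssRec k k j).1)) * (j + 1))) ^ (asssRec k k j).1 ≤
      (asssR k D).factorial * s ^ asssR k D := by
  set ρ : ℕ := (asssRec k k j).1 with hρ
  set P : ℕ := (2 * k) ^ (2 ^ D) with hP
  have h2k : 2 ≤ 2 * k := by omega
  have h1k : 1 ≤ 2 * k := by omega
  have hP1 : 1 ≤ P := Nat.one_le_pow _ _ (by omega)
  have hD2 : D + 2 ≤ 2 ^ D := add_two_le_two_pow (by omega)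
  -- `ρ ≤ (2k)^{2^D - 2}`
  have hρM : ρ ≤ (2 * k) ^ (2 ^ D - 2) := by
    have h := asssRec_fst_le hk le_rfl j
    rw [show j + 3 = D from hjD] at h
    refine h.trans (Nat.pow_le_pow_right h1k ?_)
    omega
  have hρP : ρ ≤ P := hρM.trans (Nat.pow_le_pow_right h1k (Nat.sub_le _ _))
  -- `j ≤ (2k)^{2^D - 2}` (crudely: `j ≤ D ≤ 2^D - 2 ≤ 2^{2^D-2} ≤ (2k)^{2^D-2}`)
  have hjM : j ≤ (2 * k) ^ (2 ^ D - 2) := by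
    have h1 : j ≤ 2 ^ D - 2 := by omega
    exact h1.trans ((@Nat.lt_two_pow_self (2 ^ D - 2)).le.trans (Nat.pow_le_pow_left h2k _))
  -- `Y = k(c+ρ)`: `1 ≤ Y`, `2Y ≤ P`, `Y + 1 ≤ P`
  set Y : ℕ := k * (j + ρ) with hY
  have hY1 : 1 ≤ Y := by rw [hY]; nlinarith
  have h2Y : 2 * Y ≤ P := by
    have hsum : j + ρ ≤ 2 * (2 * k) ^ (2 ^ D - 2) := by omega
    calc 2 * Y = 2 * k * (j + ρ) := by rw [hY]; ring
      _ ≤ 2 * k * (2 * (2 * k) ^ (2 ^ D - 2)) := Nat.mul_le_mul_left _ hsum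
      _ = 2 * (2 * k) * (2 * k) ^ (2 ^ D - 2) := by ring
      _ ≤ (2 * k) * (2 * k) * (2 * k) ^ (2 ^ D - 2) :=
          Nat.mul_le_mul_right _ (Nat.mul_le_mul_right _ h2k)
      _ = (2 * k) ^ (2 + (2 ^ D - 2)) := by rw [pow_add]; ring
      _ = P := by rw [hP]; congr 1; omega
  have hA1 : Y + 1 ≤ P := le_trans (by omega) h2Y
  have hj1 : j + 1 ≤ P := by
    calc j + 1 ≤ 2 ^ D := by omega
      _ ≤ 2 ^ (2 ^ D) := Nat.pow_le_pow_right (by norm_num) (@Nat.lt_two_pow_self D).le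
      _ ≤ P := Nat.pow_le_pow_left h2k _
  -- `R = P^{2D}`
  have hR : asssR k D = P ^ (2 * D) := by
    rw [asssR, hP, ← pow_mul]
    congr 1
    ring
  -- split the left-hand side
  have hsplit : ρ.factorial * ((Y + 1) ^ (j + 1) * s ^ (2 * Y * (j + 1))) ^ ρ =
      (ρ.factorial * ((Y + 1) ^ (j + 1)) ^ ρ) * s ^ (2 * Y * (j + 1) * ρ) := by
    rw [mul_pow, ← pow_mul]; ring
  rw [hsplit]
  refine Nat.mul_le_mul ?_ (Nat.pow_le_pow_right hs ?_)
  · -- `ρ!·A^ρ ≤ (ρA)! ≤ R!`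
    have hApos : 1 ≤ (Y + 1) ^ (j + 1) := Nat.one_le_pow _ _ (Nat.succ_pos _)
    refine (factorial_mul_pow_le_factorial_mul _ hApos ρ).trans (Nat.factorial_le ?_)
    calc ρ * (Y + 1) ^ (j + 1) ≤ P * P ^ (j + 1) :=
          Nat.mul_le_mul hρP (Nat.pow_le_pow_left hA1 _)
      _ = P ^ (j + 2) := by ring
      _ ≤ P ^ (2 * D) := Nat.pow_le_pow_right hP1 (by omega)
      _ = asssR k D := hR.symm
  · -- the `s`-exponent: `2Y(c+1)ρ ≤ P·P·P ≤ R`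
    calc 2 * Y * (j + 1) * ρ ≤ P * P * P :=
          Nat.mul_le_mul (Nat.mul_le_mul h2Y hj1) hρP
      _ = P ^ 3 := by ring
      _ ≤ P ^ (2 * D) := Nat.pow_le_pow_right hP1 (by omega)
      _ = asssR k D := hR.symm

end ASSS16

/-! ## Part K. The keystone for general top fan-in -/

section Keystone

/-- **FSV Thm. 48 for the WHOLE class `occurClass D k s` (unbounded top fan-in), with the
characteristic clause as the proof needs it.** Blocks: `r_ℓ := (asssRec k k ℓ).1 ≤ R = asssR k D`
for ALL `ℓ < D - 2`; block `0` (`r_0 = k ≥ 1` seeds) extracts first-order partials, blocks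
`1, …, D-3` carry the [ASSS16] level recursion at (depth `D - j`, order `j`), based at depth `3`.
Hypotheses: `k ≥ 1`, `s ≥ 1`, `D ≥ 1`; `char = 0 ∨ (s+1)^D < char` (extraction: a variable of `C`
has a non-zero partial) and `char = 0 ∨ ((s+1)^{D-j})^{r_j} < char` for `1 ≤ j ≤ D-3` (Jacobian
criterion, level by level); `Φ` hits sparsity `≤ R!·s^R`.
[cite: ForbesShpilkaVolk2018, Thm. 48 (seq.) = ToC Thm. 5.24; AgrawalEtAl2011, §4 (Thm. dDkrPIT with Lemma 4.2, Cor. 4.3) and Thm. 2.1]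
locator: paper:arxiv-1701.05328 p0021.txt:L31; paper:arxiv-1111.0582 p0009.txt:L3–L34, p0010.txt:L1–L62 -/
theorem FSV2018_thm48_of_clauses (F : Type) [Field F] (n D k s : ℕ) (τ : Type)
    (Φ : multilinearMonomials n → MvPolynomial τ F) (hk1 : 1 ≤ k) (hs1 : 1 ≤ s) (hD1 : 1 ≤ D)
    (hcharTop : ringChar F = 0 ∨ (s + 1) ^ D < ringChar F)
    (hclause : ∀ j, 1 ≤ j → j + 3 ≤ D →
      (ringChar F = 0 ∨ ((s + 1) ^ (D - j)) ^ (asssRec k k j).1 < ringChar F))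
    (hΦ : IsHittingSetGenerator
      {P : MvPolynomial (multilinearMonomials n) F |
        P.support.card ≤ (asssR k D).factorial * s ^ asssR k D} Φ) :
    ∃ r : Fin (D - 2) → Fin (asssR k D + 1),
      IsHittingSetGenerator (occurClass F (multilinearMonomials n) D k s)
        (fun m : multilinearMonomials n =>
          (∑ ℓ : Fin (D - 2),
            rename (fun v : Fin (r ℓ) ⊕ Unit =>
                (Sum.inl (ℓ, Sum.map (Fin.castLE (Nat.lt_succ_iff.mp (r ℓ).isLt)) id v) :
                  (Fin (D - 2) × (Fin (asssR k D) ⊕ Unit)) ⊕ τ))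
              (vdmGenCoeff F n (r ℓ) (m : Fin n →₀ ℕ))) +
            rename Sum.inr (Φ m)) := by
  classical
  haveI : Fintype (multilinearMonomials n) := Fintype.ofEquiv (Fin (2 ^ n)) (binaryOrder n)
  -- block sizes `r_ℓ := (asssRec k k ℓ).1 ≤ R` for every `ℓ ≤ D - 3`
  have hrB : ∀ ℓ : Fin (D - 2), (asssRec k k ℓ).1 ≤ asssR k D := fun ℓ => by
    have h := ASSS16.asssRec_fst_le_asssR_max_of_le_sub_three (k := k) (t := k) (D := D)
      (j := ℓ) hD1 (by have := ℓ.2; omega)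
    rwa [max_self] at h
  let r : Fin (D - 2) → Fin (asssR k D + 1) :=
    fun ℓ => ⟨(asssRec k k ℓ).1, Nat.lt_succ_of_le (hrB ℓ)⟩
  refine ⟨r, ?_⟩
  -- the seed slots of block `ℓ`, the blocks, the stage maps `Ψ_j` (blocks `≥ j` and `Φ`)
  set slot : (ℓ : Fin (D - 2)) → Fin (r ℓ) ⊕ Unit →
      (Fin (D - 2) × (Fin (asssR k D) ⊕ Unit)) ⊕ τ :=
    fun ℓ v => Sum.inl (ℓ, Sum.map (Fin.castLE (Nat.lt_succ_iff.mp (r ℓ).isLt)) id v) with hslot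
  set block : Fin (D - 2) → multilinearMonomials n →
      MvPolynomial ((Fin (D - 2) × (Fin (asssR k D) ⊕ Unit)) ⊕ τ) F :=
    fun ℓ mm => rename (slot ℓ) (vdmGenCoeff F n (r ℓ) (mm : Fin n →₀ ℕ)) with hblock
  set stageGen : ℕ → multilinearMonomials n →
      MvPolynomial ((Fin (D - 2) × (Fin (asssR k D) ⊕ Unit)) ⊕ τ) F :=
    fun j mm => (∑ ℓ ∈ (Finset.univ : Finset (Fin (D - 2))).filter (fun ℓ : Fin (D - 2) => j ≤ ℓ.val),
      block ℓ mm) + rename Sum.inr (Φ mm) with hstageGen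
  set Ψ : ℕ → (MvPolynomial (multilinearMonomials n) F →ₐ[F]
      MvPolynomial ((Fin (D - 2) × (Fin (asssR k D) ⊕ Unit)) ⊕ τ) F) :=
    fun j => aeval (stageGen j) with hΨ
  -- the slots are injective and pairwise apart; the stage maps split off one block at a time
  have hslotinj : ∀ ℓ, Function.Injective (slot ℓ) := by
    intro ℓ v w h
    rw [hslot] at h
    simp only [Sum.inl.injEq, Prod.mk.injEq, true_and] at h
    exact (Sum.map_injective.2 ⟨Fin.castLE_injective _, Function.injective_id⟩) h
  have hslotinr : ∀ ℓ v (w : τ), slot ℓ v ≠ Sum.inr w := by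
    intro ℓ v w h
    rw [hslot] at h
    exact Sum.inl_ne_inr h
  have hsplit : ∀ (j : ℕ) (hj : j < D - 2) (mm : multilinearMonomials n),
      stageGen j mm = block ⟨j, hj⟩ mm + stageGen (j + 1) mm := by
    intro j hj mm
    have hfilter : (Finset.univ.filter fun ℓ : Fin (D - 2) => j ≤ ℓ.val) =
        insert ⟨j, hj⟩ (Finset.univ.filter fun ℓ : Fin (D - 2) => j + 1 ≤ ℓ.val) := by
      ext ℓ
      simp only [Finset.mem_filter, Finset.mem_univ, true_and, Finset.mem_insert, Fin.ext_iff]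
      omega
    have hnot : (⟨j, hj⟩ : Fin (D - 2)) ∉
        (Finset.univ.filter fun ℓ : Fin (D - 2) => j + 1 ≤ ℓ.val) := by simp
    rw [hstageGen]
    simp only
    rw [hfilter, Finset.sum_insert hnot, add_assoc]
  have hΨsplit : ∀ (j : ℕ) (hj : j < D - 2), Ψ j = aeval (fun mm : multilinearMonomials n =>
      rename (slot ⟨j, hj⟩) (vdmGenCoeff F n (r ⟨j, hj⟩) (mm : Fin n →₀ ℕ)) + Ψ (j + 1) (X mm)) := by
    intro j hj
    refine MvPolynomial.algHom_ext fun mm => ?_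
    rw [hΨ]
    simp only [aeval_X]
    rw [hsplit j hj mm, hblock]
  have hlast : ∀ mm : multilinearMonomials n, Ψ (D - 2) (X mm) = rename Sum.inr (Φ mm) := by
    intro mm
    rw [hΨ]
    simp only [aeval_X]
    rw [hstageGen]
    simp only
    rw [Finset.filter_false_of_mem, Finset.sum_empty, zero_add]
    intro ℓ _
    exact not_le.2 ℓ.2
  -- block `j` is fresh for `Ψ_{j+1}`
  have hfresh : ∀ (j : ℕ) (hj : j < D - 2) (mm : multilinearMonomials n),
      ∀ v ∈ (Ψ (j + 1) (X mm)).vars, v ∉ Set.range (slot ⟨j, hj⟩) := by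
    intro j hj mm v hv
    rintro ⟨w, rfl⟩
    rw [hΨ] at hv
    simp only [aeval_X] at hv
    rw [hstageGen] at hv
    simp only at hv
    rcases Finset.mem_union.1 (vars_add_subset _ _ hv) with h | h
    · obtain ⟨ℓ, hℓ, hvℓ⟩ := Finset.mem_biUnion.1 (vars_sum_subset _ _ h)
      rw [hblock] at hvℓ
      obtain ⟨w', -, hw'⟩ := Finset.mem_image.1 (vars_rename _ _ hvℓ)
      have hjℓ : j + 1 ≤ (ℓ : ℕ) := (Finset.mem_filter.1 hℓ).2
      rw [hslot] at hw'
      simp only [Sum.inl.injEq, Prod.mk.injEq] at hw'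
      have := congrArg Fin.val hw'.1
      simp only at this
      omega
    · obtain ⟨w', -, hw'⟩ := Finset.mem_image.1 (vars_rename _ _ h)
      exact hslotinr _ _ _ hw'.symm
  -- `Ψ_0` is the generator of the statement
  have h0 : (Finset.univ.filter fun ℓ : Fin (D - 2) => 0 ≤ ℓ.val) = Finset.univ :=
    Finset.filter_true_of_mem fun _ _ => Nat.zero_le _
  have hgen : (fun m : multilinearMonomials n =>
      (∑ ℓ : Fin (D - 2), rename (fun v : Fin (r ℓ) ⊕ Unit =>
          (Sum.inl (ℓ, Sum.map (Fin.castLE (Nat.lt_succ_iff.mp (r ℓ).isLt)) id v) :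
            (Fin (D - 2) × (Fin (asssR k D) ⊕ Unit)) ⊕ τ))
        (vdmGenCoeff F n (r ℓ) (m : Fin n →₀ ℕ))) + rename Sum.inr (Φ m)) = stageGen 0 := by
    funext mm
    simp only [hstageGen, hblock, hslot, h0]
  have hΨ0 : ∀ Q : MvPolynomial (multilinearMonomials n) F, Ψ 0 Q =
      MvPolynomial.bind₁ (fun m : multilinearMonomials n =>
        (∑ ℓ : Fin (D - 2), rename (fun v : Fin (r ℓ) ⊕ Unit =>
            (Sum.inl (ℓ, Sum.map (Fin.castLE (Nat.lt_succ_iff.mp (r ℓ).isLt)) id v) :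
              (Fin (D - 2) × (Fin (asssR k D) ⊕ Unit)) ⊕ τ))
          (vdmGenCoeff F n (r ℓ) (m : Fin n →₀ ℕ))) + rename Sum.inr (Φ m)) Q := by
    intro Q
    rw [hgen, hΨ]
    simp only
    rw [aeval_eq_bind₁]
  -- sparse polynomials are hit by `Ψ_0` (all blocks to `0` leaves `Φ`)
  have hRpos : 0 < asssR k D := by unfold asssR; positivity
  have hsB : s ≤ (asssR k D).factorial * s ^ asssR k D :=
    (Nat.le_self_pow hRpos.ne' s).trans (Nat.le_mul_of_pos_left _ (Nat.factorial_pos _))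
  have hsparse : ∀ Q : MvPolynomial (multilinearMonomials n) F, Q ≠ 0 → Q.support.card ≤ s →
      Ψ 0 Q ≠ 0 := by
    intro Q hQ0 hQs
    rw [hΨ0]
    exact ASSS16.bind₁_vdmBlocks_add_rename_ne_zero Φ Finset.univ r (hΦ Q (hQs.trans hsB) hQ0)
  -- THE LEVEL INDUCTION (blocks `1, …, D-3`): `key i j _ _` = INV(j) for `i + j + 3 = D`, `j ≥ 1`:
  -- `Ψ_j` is faithful to every family of `≤ r_j` derivatives of order `≤ j` of sub-formulas of depth
  -- `≤ D - j`; base `j = D - 3` (depth `3`) by `ASSS16.baseLevelDepthThree`.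
  have key : ∀ i j : ℕ, i + j + 3 = D → 1 ≤ j →
      ∀ (m : ℕ) (G : Fin m → OccurFormula F (multilinearMonomials n))
        (T : Fin m → multilinearMonomials n →₀ ℕ),
        m ≤ (asssRec k k j).1 → (∀ u i', (G u).occur i' ≤ k) → (∀ u, (G u).size ≤ s) →
        (∀ u, (G u).depth ≤ D - j) → (∀ u, (T u).degree ≤ j) →
        ∀ C : MvPolynomial (Fin m) F,
          aeval (fun u => iterPderiv (A := F) (T u) (G u).eval) C ≠ 0 ↔
            aeval (fun u => Ψ j (iterPderiv (A := F) (T u) (G u).eval)) C ≠ 0 := by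
    intro i
    induction i with
    | zero =>
      intro j hj hj1 m G T hm hocc hsize hdepth hT C
      have hj' : j < D - 2 := by omega
      have hj1' : j + 1 = D - 2 := by omega
      have h3 : D - j = 3 := by omega
      rw [hΨsplit j hj']
      have hmap : (fun mm : multilinearMonomials n =>
          rename (slot ⟨j, hj'⟩) (vdmGenCoeff F n (r ⟨j, hj'⟩) (mm : Fin n →₀ ℕ)) +
            Ψ (j + 1) (X mm)) =
          fun mm : multilinearMonomials n =>
            rename (slot ⟨j, hj'⟩) (vdmGenCoeff F n (r ⟨j, hj'⟩) (mm : Fin n →₀ ℕ)) +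
              rename Sum.inr (Φ mm) := by
        funext mm
        rw [hj1', hlast]
      rw [hmap]
      have hchar := hclause j hj1 (by omega)
      rw [h3] at hchar
      exact ASSS16.baseLevelDepthThree G T hk1 hs1 hocc hsize
        (fun u => by rw [← h3]; exact hdepth u) hT hm hchar
        (ASSS16.baseThree_budget hk1 hs1 (by omega) hj1) Φ hΦ
        Sum.inr Sum.inr_injective (slot ⟨j, hj'⟩) (hslotinj ⟨j, hj'⟩) (hslotinr ⟨j, hj'⟩) C
    | succ i ih =>
      intro j hj hj1 m G T hm hocc hsize hdepth hT C
      have hj' : j < D - 2 := by omega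
      rw [hΨsplit j hj']
      refine thm48_levelInvariant_step k s (D - j) j (asssRec k k j).1 (asssRec k k (j + 1)).1
        (by omega) hk1 (le_of_eq (ASSS16.asssRec_fst_succ k k j).symm) (Ψ (j + 1)) (slot ⟨j, hj'⟩)
        (hslotinj _) (hfresh j hj') (hclause j hj1 (by omega)) ?_ m G T hm hocc hsize hdepth hT C
      intro m' H T' hm' hoccH hsizeH hdepthH hT' Q
      exact ih (j + 1) (by omega) (by omega) m' H T' hm' hoccH hsizeH
        (fun u => by have := hdepthH u; omega) hT' Q
  -- THE STRUCTURAL RECURSION over the root of the formula (size as the measure)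
  have hmain : ∀ (N : ℕ) (φ : OccurFormula F (multilinearMonomials n)), φ.size ≤ N →
      φ.depth ≤ D → (∀ i, φ.occur i ≤ k) → φ.size ≤ s → φ.eval ≠ 0 → Ψ 0 φ.eval ≠ 0 := by
    intro N
    induction N using Nat.strong_induction_on with
    | _ N ih =>
      intro φ hN hdepthφ hoccφ hsizeφ hne
      cases φ with
      | leaf p =>
        -- a leaf is sparse
        refine hsparse _ hne ?_
        rw [OccurFormula.size] at hsizeφ
        exact (ASSS16.card_support_le_leafSize p).trans hsizeφ
      | powProd ps =>
        -- a power product: recurse into the children with a positive exponent (domain)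
        obtain ⟨m, G, e, hev, hoccsum, hsz, hdp⟩ := OccurPowArgs.exists_fin_view ps
        rw [OccurFormula.eval, hev] at hne ⊢
        rw [map_prod]
        refine Finset.prod_ne_zero_iff.2 fun j _ => ?_
        rw [map_pow]
        rcases Nat.eq_zero_or_pos (e j) with h0 | hpos
        · rw [h0, pow_zero]; exact one_ne_zero
        have hGj0 : (G j).eval ≠ 0 := fun h0 =>
          hne (Finset.prod_eq_zero (Finset.mem_univ j) (by rw [h0, zero_pow hpos.ne']))
        have hszj : e j + (G j).size ≤ (OccurFormula.powProd ps).size := by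
          rw [OccurFormula.size, hsz]
          exact Finset.single_le_sum (f := fun i => e i + (G i).size) (fun _ _ => Nat.zero_le _)
            (Finset.mem_univ j)
        refine pow_ne_zero _ (ih (G j).size (by omega) (G j) le_rfl ?_ ?_ (by omega) hGj0)
        · have h1 := hdepthφ
          rw [OccurFormula.depth] at h1
          exact (hdp j).trans (by omega)
        · intro i
          have h1 := hoccφ i
          rw [OccurFormula.occur, hoccsum] at h1
          exact (Finset.single_le_sum (f := fun v => (G v).occur i) (fun _ _ => Nat.zero_le _)
            (Finset.mem_univ j)).trans h1
      | add as =>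
        -- a `+` gate: sparse if shallow; otherwise extraction + faithfulness to `≤ k` derivatives
        by_cases hd3 : (OccurFormula.add as).depth ≤ 3
        · exact hsparse _ hne
            ((ASSS16.card_support_eval_add_le_size_of_depth_le_three as hd3).trans hsizeφ)
        have hD4 : 4 ≤ D := by omega
        set P := (OccurFormula.add as).eval with hPdef
        -- constant root value: nothing to do
        by_cases hvars : P.vars = ∅
        · obtain hc := vars_eq_empty_iff_eq_C.1 hvars
          rw [hc, hΨ]
          simp only
          rw [aeval_C, algebraMap_eq]
          rw [hc] at hne
          rw [Ne, C_eq_zero] at hne ⊢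
          exact hne
        obtain ⟨mm, hmm⟩ := Finset.nonempty_iff_ne_empty.2 hvars
        -- a variable of `P` has a non-zero partial derivative (degree `≤ (s+1)^D <` char)
        have hPdeg : P.totalDegree ≤ (s + 1) ^ D :=
          totalDegree_le_of_mem_occurClass ⟨OccurFormula.add as, rfl, hdepthφ, hoccφ, hsizeφ⟩
        have hderiv : pderiv mm P ≠ 0 :=
          ASSS16.pderiv_ne_zero_of_mem_vars_of_clause hmm
            (hcharTop.imp id fun h => lt_of_le_of_lt hPdeg h)
        intro hzero
        -- EXTRACTION: `Ψ_0(P) = 0 ⟹ Ψ_1(∂_mm P) = 0`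
        have h02 : 0 < D - 2 := by omega
        have hr0 : 0 < ((r ⟨0, h02⟩ : Fin (asssR k D + 1)) : ℕ) := by
          show 0 < (asssRec k k 0).1
          exact hk1
        rw [hΨsplit 0 h02] at hzero
        have hex := ASSS16.map_pderiv_eq_zero_of_aeval_vdmBlock_add_eq_zero (Ψ 1) (slot ⟨0, h02⟩)
          (hslotinj _) (hfresh 0 h02) hr0 P hzero mm
        -- the children of the root and those involving `x_mm` (at most `k`)
        obtain ⟨m, G, hev, hoccsum, hsz, hdp⟩ := OccurArgs.exists_fin_view as
        set Um : Finset (Fin m) := Finset.univ.filter fun u => mm ∈ (G u).eval.vars with hUm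
        have hUmk : Um.card ≤ k := OccurArgs.card_filter_mem_vars_le as G hoccsum hoccφ mm
        have hPsum : P = ∑ u, (G u).eval := by rw [hPdef, OccurFormula.eval, hev]
        have hdsum : pderiv mm P = ∑ u ∈ Um, pderiv mm (G u).eval := by
          rw [hPsum, map_sum, hUm]
          exact (Finset.sum_filter_of_ne fun u _ hu => by
            by_contra hnot
            exact hu (pderiv_eq_zero_of_notMem_vars hnot)).symm
        -- the family `S = (∂_mm G_u)_{u ∈ Um}` indexed by `Fin Um.card`
        set eU : Fin Um.card ≃ Um := Um.equivFin.symm with heU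
        set H : Fin Um.card → OccurFormula F (multilinearMonomials n) := fun u' => G (eU u') with hH
        have hoccH : ∀ u' i, (H u').occur i ≤ k := fun u' i => by
          have h1 := hoccφ i
          rw [OccurFormula.occur, hoccsum] at h1
          exact (Finset.single_le_sum (f := fun v => (G v).occur i) (fun _ _ => Nat.zero_le _)
            (Finset.mem_univ _)).trans h1
        have hsizeH : ∀ u', (H u').size ≤ s := fun u' => by
          have h1 := hsizeφ
          rw [OccurFormula.size, hsz] at h1
          have h2 : (G (eU u')).size ≤ ∑ i, (G i).size :=
            Finset.single_le_sum (f := fun i => (G i).size) (fun _ _ => Nat.zero_le _)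
              (Finset.mem_univ _)
          rw [hH]
          simp only
          omega
        have hdepthH : ∀ u', (H u').depth ≤ D - 1 := fun u' => by
          have h1 := hdepthφ
          rw [OccurFormula.depth] at h1
          have := hdp (eU u')
          rw [hH]
          simp only
          omega
        have hkr1 : Um.card ≤ (asssRec k k 1).1 := by
          rw [ASSS16.asssRec_fst_succ]
          have h1 : k ≤ k * (2 * k ^ 2) := Nat.le_mul_of_pos_right k (by positivity)
          have h2 : (0 + 1) * 2 ^ (0 + 1) * k * (asssRec k k 0).1 ^ 2 = k * (2 * k ^ 2) := by
            show (0 + 1) * 2 ^ (0 + 1) * k * k ^ 2 = _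
            ring
          rw [h2]
          exact hUmk.trans h1
        have hfaith := key (D - 4) 1 (by omega) le_rfl Um.card H (fun _ => Finsupp.single mm 1) hkr1
          hoccH hsizeH hdepthH (fun _ => by rw [Finsupp.degree_single])
          (∑ u' : Fin Um.card, (X u' : MvPolynomial (Fin Um.card) F))
        have e1 : ∀ u', iterPderiv (A := F) (Finsupp.single mm 1) (H u').eval = pderiv mm (G (eU u')).eval := by
          intro u'
          rw [iterPderiv_single]
          rfl
        simp only [map_sum, aeval_X, e1] at hfaith
        -- `Σ_{u'} ∂_mm G_{eU u'} = ∂_mm P ≠ 0`, but `Ψ_1` of it is `Ψ_1(∂_mm P) = 0`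
        have hreindex : ∀ f : Fin m → MvPolynomial ((Fin (D - 2) × (Fin (asssR k D) ⊕ Unit)) ⊕ τ) F,
            ∑ u' : Fin Um.card, f (eU u') = ∑ u ∈ Um, f u := by
          intro f
          rw [Equiv.sum_comp eU (fun x : Um => f x), Finset.sum_coe_sort]
        have hreindex' : ∀ f : Fin m → MvPolynomial (multilinearMonomials n) F,
            ∑ u' : Fin Um.card, f (eU u') = ∑ u ∈ Um, f u := by
          intro f
          rw [Equiv.sum_comp eU (fun x : Um => f x), Finset.sum_coe_sort]
        have hL : ∑ u' : Fin Um.card, pderiv mm (G (eU u')).eval ≠ 0 := by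
          rw [hreindex' (fun u => pderiv mm (G u).eval), ← hdsum]
          exact hderiv
        have hRzero : ∑ u' : Fin Um.card, Ψ 1 (pderiv mm (G (eU u')).eval) = 0 := by
          rw [hreindex (fun u => Ψ 1 (pderiv mm (G u).eval)), ← map_sum, ← hdsum]
          exact hex
        exact (hfaith.1 hL) hRzero
  -- THE GENERATOR STATEMENT
  intro P hP hP0
  obtain ⟨φ, hPeval, hdepthC, hoccC, hsizeC⟩ := hP
  have h := hmain φ.size φ le_rfl hdepthC hoccC hsizeC (by rw [hPeval]; exact hP0)
  rw [hPeval, hΨ0] at h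
  exact h

/-- **`FSV2018_thm48` — Forbes–Shpilka–Volk Thm. 48 AS PRINTED (generator for ALL depth-`D`
occur-`k` size-`s` formulas, abstract sparse-hitting `Φ`, `D - 2` Vandermonde blocks of `≤ R`
seeds, `char = 0 ∨ s^R < char`) — the named fact DISCHARGED.** The typed clause is converted for
`s ≥ 2` by val-lit t21's `char_clause_of_level_sub_three` (every threshold used is `≤ s^R`); `s ≤ 1`
(constants: `isHittingSetGenerator_occurClass_of_le_one`), `k = 0` (occur-`0` formulas are constants:
`exists_eval_eq_C_of_occur_eq_zero`) and `D = 0` (empty class) are degenerate.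
[cite: ForbesShpilkaVolk2018, Thm. 48 (seq.) = ToC Thm. 5.24; AgrawalEtAl2011, §4 (Thm. dDkrPIT)]
locator: paper:arxiv-1701.05328 p0021.txt:L31; paper:doi-10-4086-toc-2018-v014a018 p0030.txt:L6 -/
theorem FSV2018_thm48_holds : FSV2018_thm48 := by
  intro F _ n D k s τ Φ hchar hΦ
  -- `s ≤ 1`: every formula of the class computes a constant
  rcases Nat.lt_or_ge s 2 with hs | hs
  · exact ⟨fun _ => ⟨0, Nat.succ_pos _⟩, isHittingSetGenerator_occurClass_of_le_one _ (by omega)⟩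
  -- `k = 0`: no variable occurs, constants again
  rcases Nat.eq_zero_or_pos k with hk0 | hk1
  · subst hk0
    refine ⟨fun _ => ⟨0, Nat.succ_pos _⟩, fun P hP hP0 => ?_⟩
    obtain ⟨φ, hPeval, -, hocc, -⟩ := hP
    obtain ⟨c, hc⟩ := OccurFormula.exists_eval_eq_C_of_occur_eq_zero φ
      fun i => Nat.le_zero.1 (hocc i)
    rw [← hPeval, hc, bind₁_C_right]
    rw [← hPeval, hc] at hP0
    rw [Ne, C_eq_zero] at hP0 ⊢
    exact hP0
  -- `D = 0`: the class is empty (every formula has depth `≥ 1`)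
  rcases Nat.eq_zero_or_pos D with hD0 | hD1
  · subst hD0
    refine ⟨fun ℓ => ⟨0, Nat.succ_pos _⟩, fun P hP _ => ?_⟩
    obtain ⟨φ, -, hd, -, -⟩ := hP
    have := OccurFormula.one_le_depth φ
    omega
  -- the main case: convert the typed clause
  have hchar' : ringChar F = 0 ∨ s ^ asssR (max k k) D < ringChar F := by rwa [max_self]
  have hcharTop : ringChar F = 0 ∨ (s + 1) ^ D < ringChar F := by
    have h := ASSS16.char_clause_of_level_sub_three (F := F) (k := k) (t := k) (j := 0)
      (d := (s + 1) ^ D) (r := 1) hs hD1 (Nat.zero_le _) le_rfl hk1 hchar'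
    rwa [pow_one] at h
  have hclause : ∀ j, 1 ≤ j → j + 3 ≤ D →
      (ringChar F = 0 ∨ ((s + 1) ^ (D - j)) ^ (asssRec k k j).1 < ringChar F) :=
    fun j _ hj => ASSS16.char_clause_of_level_sub_three (F := F) (k := k) (t := k) (j := j)
      (d := (s + 1) ^ (D - j)) (r := (asssRec k k j).1) hs hD1 (by omega)
      (Nat.pow_le_pow_right (Nat.succ_pos s) (Nat.sub_le _ _)) le_rfl hchar'
  exact FSV2018_thm48_of_clauses F n D k s τ Φ hk1 (by omega) hD1 hcharTop hclause hΦ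

end Keystone

end Literature.Computability.AlgebraicComplexity

/-! ## APPENDIX (restored verbatim): val-lit t18 g9's assembly `FSV2018_thm48_of_baseLevelDepthThree` (p543046)

The gate accepted t18 g9's conditional assembly p543046 at this path at 15:24Z and p2 g9's self-contained file
p543182 (written in parallel, before RULING (121)) at 15:27Z, which REPLACED it; this append restores t18 g9's
declarations byte-for-byte (module docstring below, then its sections), so that both routes to `FSV2018_thm48` are in
the tree: `FSV2018_thm48_holds` (above) and `FSV2018_thm48_of_baseLevelDepthThree` (below, hypothesis `hBase` =
`ASSS16.baseLevelDepthThree` as landed in `AC/ASSS16BaseLevelDepthThree.lean`). -/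

/-!
# FSV 2018 Thm. 48 AS TYPED (generator form, abstract sparse-hitting `Φ`, general top fan-in)
# — the assembly: reduced to ONE depth-3 base lemma (`ASSS16.baseLevelDepthThree`)

Forbes–Shpilka–Volk [ForbesShpilkaVolk2018] Thm. 48 (= ToC Thm. 5.24; tree: the named fact
`FSV2018_thm48`, `AC/FSV18SuccinctGenerators.lean`): "Suppose `Φ(w) : 𝔽^m → 𝔽^N` is a map such that
for any polynomial `F(X)` of sparsity at most `R!·s^R`, `F ∘ Φ ≢ 0`. Then there exist integers
`r_1, …, r_{D-2} ∈ [R]`, for `R = (2k)^{2D·2^D}` such that the map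
`Ψ : X_i ↦ Σ_{ℓ=1}^{D-2} (Σ_{j=1}^{r_ℓ} y_{j,ℓ} t_ℓ^{ij}) + Φ(w)` is a generator for polynomials computed
by depth-`D` occur-`k` formulas of size `s` assuming `char(𝔽) = 0` or `char(𝔽) > s^R`" — quoted
there as "(a variant of) a theorem proved by Agrawal et al." [AgrawalEtAl2011, §4, Thm. dDkrPIT].
Provenance caveat of the val-lit cell (registry B21/B23): [ASSS16] §4 prove the faithful-map /
generator statement only after reducing the TOP FAN-IN to `≤ k` by a hitting-SET step (the shifts
`x ↦ x + e_i`, arXiv:1111.0582 p0009:L3–L22); the tree PROVES that reduced form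
(`FSV2018_thm48_topFanIn_holds`, `AC/FSV18Thm48TopFanInHolds.lean`) and Cor. 49
(`FSV2018_cor49_holds`). The typed statement — generator form for the WHOLE class `occurClass D k s`
(no top-fan-in bound), abstract `Φ`, the printed `R` and the printed `D - 2` blocks — is not literally
covered by the printed proof.

This file (val-lit t18 g9, for the programme of val-lit p2 g9, memo
`HOME/np/MEMO-p2g9-FSV-thm48-general.md`, lead-np RULING (119)) assembles a proof of the typed
statement from the tree's [ASSS16] machinery and ONE new depth-3 base lemma, which it takes as a
HYPOTHESIS (stated verbatim as the memo's §5(a) signature; to be supplied by p2 g9's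
`ASSS16.baseLevelDepthThree`, `AC/ASSS16BaseLevelDepthThree.lean`):

* Block layout (FSV's, `Fin (D-2)` blocks of `≤ R` seeds): block `ℓ` has `r_ℓ := (asssRec k k ℓ).1`
  seeds (`r_0 = k`, `r_{ℓ+1} = (ℓ+1)·2^{ℓ+1}·k·r_ℓ²`, all `≤ R`, val-lit t21's
  `ASSS16.asssRec_fst_le_asssR_max_of_le_sub_three`) — the SAME layout as the keystone
  `FSV2018_thm48_topFanIn_of_clause` at `t = k`; `Ψ_j` = blocks `≥ j` plus `Φ`.
* ROOT RECURSION (new; general top fan-in is met ONLY here): by strong induction on the size of the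
  formula `C ≠ 0`: a leaf is `s`-sparse, hit by `Φ`, hence by `Ψ_0` (p2's
  `ASSS16.bind₁_vdmBlocks_add_rename_ne_zero`); a `×∧` gate is a product of powers of its non-zero
  children of smaller size (`𝔽[…]` is a domain); a `+` gate `C = Σ_u T_u` (ANY number of children) that
  is not a constant involves some `x_m`, and `∂_m C ≠ 0` (degree `≤ (s+1)^D < char`, p2's
  `ASSS16.pderiv_ne_zero_of_mem_vars_of_clause`); if `Ψ_0(C) = 0` then EXTRACTION along the first seed
  of block `0` (p2 g9's `ASSS16.map_pderiv_eq_zero_of_aeval_vdmBlock_add_eq_zero`,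
  `AC/FSV18VandermondeExtraction.lean`) gives `Ψ_1(∂_m C) = 0`; but `∂_m C = Σ_{u : x_m ∈ T_u} ∂_m T_u`
  has at most `k` summands (occur-`k`, val-lit t21's `OccurArgs.card_filter_mem_vars_le`), a LINEAR
  polynomial in a family of `≤ k ≤ r_1` first-order derivatives of depth-`≤ D-1` sub-formulas, to which
  `Ψ_1` is faithful (`INV(1)` below) — so `Ψ_1(∂_m C) ≠ 0`, contradiction. (`D = 3`: the children are
  sparse leaves, `∂_m C` is `s`-sparse and `Ψ_1 = Φ` hits it directly; `D ≤ 2`: a `+` gate is constant.)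
* LEVEL RECURSION `INV(j)`, `1 ≤ j ≤ D-3`: `Ψ_j` is faithful (Thm. 2.1 form) to every family of
  `≤ r_j` derivatives of order `≤ j` of occur-`k` size-`≤ s` sub-formulas of depth `≤ D - j` — the
  tree's one-level lemma `thm48_levelInvariant_step` (keystone Part B: Fact 1, Lemma 4.2 =
  `ASSS16.descentJacobian`, Cor. 4.3 = `ASSS16.descentFaithful`) at `(d, c, r_j, r_{j+1}) =
  (D - j, j, r_j, r_{j+1})` for `j ≤ D - 4`, and at `j = D - 3` (depth `≤ 3`: gates over sparse
  leaves) the HYPOTHESIS `hBase` with the sparsity budget of val-lit t20 g10's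
  `ASSS16.depthThree_budget_le` (`AC/ASSS16DepthThreeNumerics.lean`).
* Characteristic: the TYPED clause `char = 0 ∨ s^R < char` implies every clause used
  (`(s+1)^D < char` for the extraction, `((s+1)^{D-j})^{r_j} < char` at level `j`) for `s ≥ 2`
  (t21's `ASSS16.char_clause_of_level_sub_three`); `s ≤ 1` / `k = 0`: constants
  (`isHittingSetGenerator_occurClass_of_le_one`, `OccurFormula.exists_eval_eq_C_of_occur_eq_zero`).

Main result: `FSV2018_thm48_of_baseLevelDepthThree : (depth-3 base lemma) → FSV2018_thm48`.
Theorem-only: no definitions, no named facts (the base lemma is a hypothesis BINDER, spelled out in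
the statement, not a `def`); census-neutral until the base lemma lands, then the closer is the
one-liner `FSV2018_thm48_of_baseLevelDepthThree ASSS16.baseLevelDepthThree`. Honest framing: a
hitting-set-generator theorem for bounded-depth bounded-occur formulas (PIT literature); the route
through extraction is NOT the printed one (which this typed statement does not have); `VP ≠ VNP` is
NOT proved and nothing here bears on it. bears_on: V4 (N-row FSV2018-A, `FSV2018_thm48`).

## References
* [AgrawalEtAl2011] M. Agrawal, C. Saha, R. Saptharishi, N. Saxena, *Jacobian hits circuits:
  hitting-sets, lower bounds for depth-D occur-k formulas & depth-3 transcendence degree-k circuits*,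
  STOC 2012 / SIAM J. Comput. 45(4) (2016), arXiv:1111.0582 — §2 (Fact 1, Thm. 2.1, Lemma 2.2),
  §4 (Lemma 4.1, Lemma 4.2, Cor. 4.3, Thm. dDkrPIT and its top-fan-in reduction, p0009:L3–L22,
  p0010:L1–L62).
* [ForbesShpilkaVolk2018] M. A. Forbes, A. Shpilka, B. L. Volk, *Succinct hitting sets and barriers to
  proving lower bounds for algebraic circuits*, Theory of Computing 14(18) (2018), arXiv:1701.05328 —
  Def. 45, Construction 46, Thm. 48 (seq.) = ToC Def. 5.21, Constr. 5.22, Thm. 5.24 (p. 30;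
  locator paper:arxiv-1701.05328 p0021.txt:L31).
-/

namespace Literature.Computability.AlgebraicComplexity

open MvPolynomial Finset Literature.Barriers.ValiantsHypothesis
open Literature.RepresentationTheory.AlgebraicGroups (iterPderiv iterPderiv_zero iterPderiv_single)

/-! ## Part A. Derivatives do not increase sparsity -/

section Prelim

variable {F : Type*} [Field F]

/-- `|supp ∂_i p| ≤ |supp p|` (a special case of val-lit t21's `ASSS16.card_support_iterPderiv_le`).
[cite: AgrawalEtAl2011, §4, proof of Thm. dDkrPIT ("a sparse polynomial with sparsity bounded by `s^R`")]
locator: paper:arxiv-1111.0582 p0010.txt:L53–L55 -/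
theorem card_support_pderiv_le {σ : Type*} [DecidableEq σ] (i : σ) (p : MvPolynomial σ F) :
    (pderiv i p).support.card ≤ p.support.card := by
  have h := ASSS16.card_support_iterPderiv_le (F := F) (Finsupp.single i 1) p
  rw [iterPderiv_single] at h
  exact h

/-- `∂_i` of a sum over a finset is supported on at most `Σ_u |supp p_u|` monomials. [folklore] -/
private theorem card_support_sum_pderiv_le {σ κ : Type*} [DecidableEq σ] (i : σ) (S : Finset κ)
    (p : κ → MvPolynomial σ F) :
    (∑ u ∈ S, pderiv i (p u)).support.card ≤ ∑ u ∈ S, (p u).support.card := by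
  classical
  calc (∑ u ∈ S, pderiv i (p u)).support.card
      ≤ (S.biUnion fun u => (pderiv i (p u)).support).card := Finset.card_le_card support_sum
    _ ≤ ∑ u ∈ S, (pderiv i (p u)).support.card := Finset.card_biUnion_le
    _ ≤ ∑ u ∈ S, (p u).support.card := Finset.sum_le_sum fun u _ => card_support_pderiv_le i (p u)

end Prelim

/-! ## Part B. The assembly: `FSV2018_thm48` from the depth-3 base lemma -/

section Assembly

/-- **FSV Thm. 48 AS TYPED, reduced to the depth-3 base lemma.** The hypothesis `hBase` is the
statement of val-lit p2 g9's `ASSS16.baseLevelDepthThree` (memo MEMO-p2g9-FSV-thm48-general.md §5(a),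
verbatim): at the level of the depth-`≤ 3` sub-formulas (gates over sparse leaves), the map
`Vdm_r(y,t) ⊕ ι∘Φ` is faithful (Thm. 2.1 form) to every family of `m ≤ r` derivatives of order `≤ c`
of occur-`k` size-`≤ s` depth-`≤ 3` formulas, provided `char = 0 ∨ ((s+1)^3)^r < char` and `Φ` hits
every polynomial with at most `B ≥ r!·((k(c+r)+1)^{c+1}·s^{2k(c+r)(c+1)})^r` monomials. Given it,
the typed `FSV2018_thm48` follows by the root recursion / extraction / level recursion described in
the module docstring, with block sizes `r_ℓ = (asssRec k k ℓ).1 ≤ R = (2k)^{2D·2^D}`.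
[cite: ForbesShpilkaVolk2018, Thm. 48 (seq.) = ToC Thm. 5.24; AgrawalEtAl2011, §4 (Thm. dDkrPIT, Lemma 4.2, Cor. 4.3)]
locator: paper:arxiv-1701.05328 p0021.txt:L31; paper:arxiv-1111.0582 p0009.txt:L3–L34, p0010.txt:L1–L62 -/
theorem FSV2018_thm48_of_baseLevelDepthThree
    (hBase : ∀ {F : Type} [Field F] {n m r c k s B : ℕ} {σ τ : Type}
      (G : Fin m → OccurFormula F (multilinearMonomials n))
      (T : Fin m → multilinearMonomials n →₀ ℕ),
      1 ≤ k → 1 ≤ s → (∀ u i, (G u).occur i ≤ k) → (∀ u, (G u).size ≤ s) →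
      (∀ u, (G u).depth ≤ 3) → (∀ u, (T u).degree ≤ c) → m ≤ r →
      (ringChar F = 0 ∨ ((s + 1) ^ 3) ^ r < ringChar F) →
      r.factorial * ((k * (c + r) + 1) ^ (c + 1) * s ^ (2 * (k * (c + r)) * (c + 1))) ^ r ≤ B →
      ∀ (Φ : multilinearMonomials n → MvPolynomial τ F),
      IsHittingSetGenerator
        {P : MvPolynomial (multilinearMonomials n) F | P.support.card ≤ B} Φ →
      ∀ (ι : τ → σ), Function.Injective ι →
      ∀ (emb : Fin r ⊕ Unit → σ), Function.Injective emb → (∀ v w, emb v ≠ ι w) →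
      ∀ C : MvPolynomial (Fin m) F,
        (aeval (fun u => iterPderiv (A := F) (T u) (G u).eval) C ≠ 0 ↔
          aeval (fun u => aeval (fun mm : multilinearMonomials n =>
            rename emb (vdmGenCoeff F n r (mm : Fin n →₀ ℕ)) + rename ι (Φ mm))
              (iterPderiv (A := F) (T u) (G u).eval)) C ≠ 0)) :
    FSV2018_thm48 := by
  intro F _ n D k s τ Φ hchar hΦ
  classical
  haveI : Fintype (multilinearMonomials n) := Fintype.ofEquiv (Fin (2 ^ n)) (binaryOrder n)
  -- `s ≤ 1`: every formula of the class computes a constant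
  rcases Nat.lt_or_ge s 2 with hs2 | hs2
  · exact ⟨fun _ => ⟨0, Nat.succ_pos _⟩,
      isHittingSetGenerator_occurClass_of_le_one _ (by omega)⟩
  have hs1 : 1 ≤ s := by omega
  -- `k = 0`: no variable occurs, the formula computes a constant
  rcases Nat.eq_zero_or_pos k with hk0 | hk1
  · subst hk0
    refine ⟨fun _ => ⟨0, Nat.succ_pos _⟩, fun P hP hP0 => ?_⟩
    obtain ⟨φ, hφ, -, hocc, -⟩ := hP
    obtain ⟨c, hc⟩ := OccurFormula.exists_eval_eq_C_of_occur_eq_zero φ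
      fun i => Nat.le_zero.1 (hocc i)
    rw [← hφ, hc] at hP0 ⊢
    rw [bind₁_C_right, Ne, C_eq_zero]
    rwa [Ne, C_eq_zero] at hP0
  -- block sizes `r_ℓ := (asssRec k k ℓ).1 ≤ R` (block `0`: `k` seeds — the extraction block)
  have hrB : ∀ ℓ : Fin (D - 2), (asssRec k k ℓ).1 ≤ asssR k D := fun ℓ => by
    have h := ASSS16.asssRec_fst_le_asssR_max_of_le_sub_three (k := k) (t := k) (D := D)
      (j := ℓ) (by have := ℓ.2; omega) (by have := ℓ.2; omega)
    rwa [max_self] at h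
  let r : Fin (D - 2) → Fin (asssR k D + 1) :=
    fun ℓ => ⟨(asssRec k k ℓ).1, Nat.lt_succ_of_le (hrB ℓ)⟩
  refine ⟨r, ?_⟩
  -- the seed slots of block `ℓ`, the blocks, the stage maps `Ψ_j` (blocks `≥ j` and `Φ`)
  set slot : (ℓ : Fin (D - 2)) → Fin (r ℓ) ⊕ Unit →
      (Fin (D - 2) × (Fin (asssR k D) ⊕ Unit)) ⊕ τ :=
    fun ℓ v => Sum.inl (ℓ, Sum.map (Fin.castLE (Nat.lt_succ_iff.mp (r ℓ).isLt)) id v) with hslot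
  set block : Fin (D - 2) → multilinearMonomials n →
      MvPolynomial ((Fin (D - 2) × (Fin (asssR k D) ⊕ Unit)) ⊕ τ) F :=
    fun ℓ mm => rename (slot ℓ) (vdmGenCoeff F n (r ℓ) (mm : Fin n →₀ ℕ)) with hblock
  set stageGen : ℕ → multilinearMonomials n →
      MvPolynomial ((Fin (D - 2) × (Fin (asssR k D) ⊕ Unit)) ⊕ τ) F :=
    fun j mm => (∑ ℓ ∈ (Finset.univ : Finset (Fin (D - 2))).filter (fun ℓ : Fin (D - 2) => j ≤ ℓ.val),
      block ℓ mm) + rename Sum.inr (Φ mm) with hstageGen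
  set Ψ : ℕ → (MvPolynomial (multilinearMonomials n) F →ₐ[F]
      MvPolynomial ((Fin (D - 2) × (Fin (asssR k D) ⊕ Unit)) ⊕ τ) F) :=
    fun j => aeval (stageGen j) with hΨ
  -- the slots are injective and pairwise apart; the stage maps split off one block at a time
  have hslotinj : ∀ ℓ, Function.Injective (slot ℓ) := by
    intro ℓ v w h
    rw [hslot] at h
    simp only [Sum.inl.injEq, Prod.mk.injEq, true_and] at h
    exact (Sum.map_injective.2 ⟨Fin.castLE_injective _, Function.injective_id⟩) h
  have hslotinr : ∀ ℓ v (w : τ), slot ℓ v ≠ Sum.inr w := by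
    intro ℓ v w h
    rw [hslot] at h
    exact Sum.inl_ne_inr h
  have hsplit : ∀ (j : ℕ) (hj : j < D - 2) (mm : multilinearMonomials n),
      stageGen j mm = block ⟨j, hj⟩ mm + stageGen (j + 1) mm := by
    intro j hj mm
    have hfilter : (Finset.univ.filter fun ℓ : Fin (D - 2) => j ≤ ℓ.val) =
        insert ⟨j, hj⟩ (Finset.univ.filter fun ℓ : Fin (D - 2) => j + 1 ≤ ℓ.val) := by
      ext ℓ
      simp only [Finset.mem_filter, Finset.mem_univ, true_and, Finset.mem_insert, Fin.ext_iff]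
      omega
    have hnot : (⟨j, hj⟩ : Fin (D - 2)) ∉
        (Finset.univ.filter fun ℓ : Fin (D - 2) => j + 1 ≤ ℓ.val) := by simp
    rw [hstageGen]
    simp only
    rw [hfilter, Finset.sum_insert hnot, add_assoc]
  have hΨsplit : ∀ (j : ℕ) (hj : j < D - 2), Ψ j = aeval (fun mm : multilinearMonomials n =>
      rename (slot ⟨j, hj⟩) (vdmGenCoeff F n (r ⟨j, hj⟩) (mm : Fin n →₀ ℕ)) + Ψ (j + 1) (X mm)) := by
    intro j hj
    refine MvPolynomial.algHom_ext fun mm => ?_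
    rw [hΨ]
    simp only [aeval_X]
    rw [hsplit j hj mm, hblock]
  have hlast : ∀ mm : multilinearMonomials n, Ψ (D - 2) (X mm) = rename Sum.inr (Φ mm) := by
    intro mm
    rw [hΨ]
    simp only [aeval_X]
    rw [hstageGen]
    simp only
    rw [Finset.filter_false_of_mem, Finset.sum_empty, zero_add]
    intro ℓ _
    exact not_le.2 ℓ.2
  -- block `j` is fresh for `Ψ_{j+1}`
  have hfresh : ∀ (j : ℕ) (hj : j < D - 2) (mm : multilinearMonomials n),
      ∀ v ∈ (Ψ (j + 1) (X mm)).vars, v ∉ Set.range (slot ⟨j, hj⟩) := by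
    intro j hj mm v hv
    rintro ⟨w, rfl⟩
    rw [hΨ] at hv
    simp only [aeval_X] at hv
    rw [hstageGen] at hv
    simp only at hv
    rcases Finset.mem_union.1 (vars_add_subset _ _ hv) with h | h
    · obtain ⟨ℓ, hℓ, hvℓ⟩ := Finset.mem_biUnion.1 (vars_sum_subset _ _ h)
      rw [hblock] at hvℓ
      obtain ⟨w', -, hw'⟩ := Finset.mem_image.1 (vars_rename _ _ hvℓ)
      have hjℓ : j + 1 ≤ (ℓ : ℕ) := (Finset.mem_filter.1 hℓ).2
      rw [hslot] at hw'
      simp only [Sum.inl.injEq, Prod.mk.injEq] at hw'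
      have := congrArg Fin.val hw'.1
      simp only at this
      omega
    · obtain ⟨w', -, hw'⟩ := Finset.mem_image.1 (vars_rename _ _ h)
      exact hslotinr _ _ _ hw'.symm
  -- the generator of the statement is `Ψ_0`
  have h0 : (Finset.univ.filter fun ℓ : Fin (D - 2) => 0 ≤ ℓ.val) = Finset.univ :=
    Finset.filter_true_of_mem fun _ _ => Nat.zero_le _
  have hgen : (fun m : multilinearMonomials n =>
      (∑ ℓ : Fin (D - 2), rename (fun v : Fin (r ℓ) ⊕ Unit =>
          (Sum.inl (ℓ, Sum.map (Fin.castLE (Nat.lt_succ_iff.mp (r ℓ).isLt)) id v) :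
            (Fin (D - 2) × (Fin (asssR k D) ⊕ Unit)) ⊕ τ))
        (vdmGenCoeff F n (r ℓ) (m : Fin n →₀ ℕ))) + rename Sum.inr (Φ m)) = stageGen 0 := by
    funext mm
    simp only [hstageGen, hblock, hslot, h0]
  -- the characteristic clauses used, all from the typed one (`s ≥ 2`)
  have hchar' : ringChar F = 0 ∨ s ^ asssR (max k k) D < ringChar F := by rwa [max_self]
  have hclause : ∀ j d : ℕ, j + 3 ≤ D → d ≤ (s + 1) ^ D →
      (ringChar F = 0 ∨ d ^ (asssRec k k j).1 < ringChar F) := fun j d hj hd =>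
    ASSS16.char_clause_of_level_sub_three hs2 (by omega) (by omega) hd le_rfl hchar'
  -- `Ψ_0` hits every polynomial that `Φ` hits, in particular every `s`-sparse one
  have hR1 : 1 ≤ asssR k D := Nat.one_le_pow _ _ (by omega)
  have hsR : s ≤ (asssR k D).factorial * s ^ asssR k D :=
    (Nat.le_self_pow (by omega) s).trans (Nat.le_mul_of_pos_left _ (Nat.factorial_pos _))
  have hsparse : ∀ P : MvPolynomial (multilinearMonomials n) F, P.support.card ≤ s → P ≠ 0 →
      Ψ 0 P ≠ 0 := by
    intro P hP hP0
    have h := ASSS16.bind₁_vdmBlocks_add_rename_ne_zero Φ Finset.univ r (hΦ P (hP.trans hsR) hP0)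
    rw [hgen] at h
    exact h
  -- THE LEVEL RECURSION: `key i j _ _` = INV(j) for `i + j + 3 = D`, `1 ≤ j`
  have key : ∀ i j : ℕ, i + j + 3 = D → 1 ≤ j →
      ∀ (m : ℕ) (G : Fin m → OccurFormula F (multilinearMonomials n))
        (T : Fin m → multilinearMonomials n →₀ ℕ),
        m ≤ (asssRec k k j).1 → (∀ u i', (G u).occur i' ≤ k) → (∀ u, (G u).size ≤ s) →
        (∀ u, (G u).depth ≤ D - j) → (∀ u, (T u).degree ≤ j) →
        ∀ C : MvPolynomial (Fin m) F,
          aeval (fun u => iterPderiv (A := F) (T u) (G u).eval) C ≠ 0 ↔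
            aeval (fun u => Ψ j (iterPderiv (A := F) (T u) (G u).eval)) C ≠ 0 := by
    intro i
    induction i with
    | zero =>
      -- the base level `j = D - 3`: sub-formulas of depth `≤ 3`, the hypothesis `hBase`
      intro j hj hj1 m G T hm hocc hsize hdepth hT C
      have hj' : j < D - 2 := by omega
      have hj1' : j + 1 = D - 2 := by omega
      have h3 : D - j = 3 := by omega
      rw [hΨsplit j hj']
      have hmap : (fun mm : multilinearMonomials n =>
          rename (slot ⟨j, hj'⟩) (vdmGenCoeff F n (r ⟨j, hj'⟩) (mm : Fin n →₀ ℕ)) +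
            Ψ (j + 1) (X mm)) =
          fun mm : multilinearMonomials n =>
            rename (slot ⟨j, hj'⟩) (vdmGenCoeff F n (r ⟨j, hj'⟩) (mm : Fin n →₀ ℕ)) +
              rename Sum.inr (Φ mm) := by
        funext mm
        rw [hj1', hlast]
      rw [hmap]
      have hchar3 := hclause j ((s + 1) ^ 3) (by omega)
        (Nat.pow_le_pow_right (Nat.succ_pos s) (by omega))
      refine hBase G T hk1 hs1 hocc hsize (fun u => by rw [← h3]; exact hdepth u) hT hm hchar3
        (ASSS16.depthThree_budget_le hk1 (by omega) hs1 (by rw [show D - 3 = j from by omega])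
          (by omega)) Φ hΦ Sum.inr Sum.inr_injective
        (slot ⟨j, hj'⟩) (hslotinj ⟨j, hj'⟩) (hslotinr ⟨j, hj'⟩) C
    | succ i ih =>
      intro j hj hj1 m G T hm hocc hsize hdepth hT C
      have hj' : j < D - 2 := by omega
      rw [hΨsplit j hj']
      refine thm48_levelInvariant_step k s (D - j) j (asssRec k k j).1 (asssRec k k (j + 1)).1
        (by omega) hk1 (le_of_eq (ASSS16.asssRec_fst_succ k k j).symm) (Ψ (j + 1)) (slot ⟨j, hj'⟩)
        (hslotinj _) (hfresh j hj')
        (hclause j ((s + 1) ^ (D - j)) (by omega)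
          (Nat.pow_le_pow_right (Nat.succ_pos s) (by omega)))
        ?_ m G T hm hocc hsize hdepth hT C
      intro m' H T' hm' hoccH hsizeH hdepthH hT' Q
      exact ih (j + 1) (by omega) (by omega) m' H T' hm' hoccH hsizeH
        (fun u => by have := hdepthH u; omega) hT' Q
  -- THE `+` GATES (general fan-in): extraction along the first seed of block `0`
  have hadd : ∀ as : OccurArgs F (multilinearMonomials n), (OccurFormula.add as).depth ≤ D →
      (∀ i, (OccurFormula.add as).occur i ≤ k) → (OccurFormula.add as).size ≤ s →
      as.evalSum ≠ 0 → Ψ 0 as.evalSum ≠ 0 := by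
    intro as hdepthC hoccC hsizeC hP0 h0
    set P := as.evalSum with hPdef
    -- `P` is not a constant: it involves some variable `x_mm`
    have hPvars : P.vars ≠ ∅ := by
      intro hv
      rw [vars_eq_empty_iff_eq_C] at hv
      apply hP0
      have h1 : Ψ 0 P = C (P.coeff 0) := by rw [hv, coeff_C, if_pos rfl]; exact (aeval_C _ _)
      have h2 : (P.coeff 0) = 0 := by
        have := h0
        rw [h1, C_eq_zero] at this
        exact this
      rw [hv, h2, C_0]
    obtain ⟨mm, hmm⟩ := Finset.nonempty_iff_ne_empty.2 hPvars
    have hdepthAs : as.depth + 1 ≤ D := by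
      have h1 := hdepthC
      rw [OccurFormula.depth] at h1
      omega
    -- so the gate has depth `≥ 3` (children of depth `≤ 1` are constants)
    have hD3 : 3 ≤ D := by
      by_contra hlt
      obtain ⟨c, hc⟩ := OccurArgs.exists_evalSum_eq_C_of_depth_le_one as (by omega)
      apply hPvars
      rw [hPdef, hc, vars_C]
    have hmem : P ∈ occurClass F (multilinearMonomials n) D k s :=
      ⟨OccurFormula.add as, rfl, hdepthC, hoccC, hsizeC⟩
    have hcharP : ringChar F = 0 ∨ P.totalDegree < ringChar F := by
      have h1 := hclause 0 ((s + 1) ^ D) (by omega) le_rfl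
      rw [show (asssRec k k 0).1 = k from rfl] at h1
      refine h1.imp id fun hlt => lt_of_le_of_lt ?_ hlt
      exact (totalDegree_le_of_mem_occurClass hmem).trans (Nat.le_self_pow (by omega) _)
    have hdP : pderiv mm P ≠ 0 := ASSS16.pderiv_ne_zero_of_mem_vars_of_clause hmm hcharP
    -- extraction from block `0` (`k ≥ 1` seeds)
    have h0' : 0 < D - 2 := by omega
    have hzero : aeval (fun mm : multilinearMonomials n =>
        rename (slot ⟨0, h0'⟩) (vdmGenCoeff F n (r ⟨0, h0'⟩) (mm : Fin n →₀ ℕ)) +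
          Ψ (0 + 1) (X mm)) P = 0 := by
      rw [← hΨsplit 0 h0']
      exact h0
    have hex : Ψ 1 (pderiv mm P) = 0 :=
      ASSS16.map_pderiv_eq_zero_of_aeval_vdmBlock_add_eq_zero (Ψ (0 + 1)) (slot ⟨0, h0'⟩)
        (hslotinj _) (hfresh 0 h0') hk1 P hzero mm
    -- the children of the gate carrying `x_mm`: at most `k` of them
    obtain ⟨m, G, hev, hoccsum, hsz, hdp⟩ := OccurArgs.exists_fin_view as
    set S : Finset (Fin m) := Finset.univ.filter fun u => mm ∈ (G u).eval.vars with hS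
    have hScard : S.card ≤ k := OccurArgs.card_filter_mem_vars_le as G hoccsum hoccC mm
    have hdsum : pderiv mm P = ∑ u ∈ S, pderiv mm (G u).eval := by
      rw [hPdef, hev, map_sum, ← Finset.sum_filter_add_sum_filter_not Finset.univ
        (fun u => mm ∈ (G u).eval.vars), Finset.sum_eq_zero (s := Finset.univ.filter
          fun u => ¬ mm ∈ (G u).eval.vars), add_zero]
      intro u hu
      exact pderiv_eq_zero_of_notMem_vars (Finset.mem_filter.1 hu).2
    have hoccG : ∀ u i, (G u).occur i ≤ k := fun u i => by
      have h1 := hoccC i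
      rw [OccurFormula.occur, hoccsum] at h1
      exact (Finset.single_le_sum (f := fun v => (G v).occur i) (fun _ _ => Nat.zero_le _)
        (Finset.mem_univ u)).trans h1
    have hsizeAs : ∑ u, (G u).size ≤ s := by
      have h1 := hsizeC
      rw [OccurFormula.size, hsz] at h1
      omega
    have hsizeG : ∀ u, (G u).size ≤ s := fun u =>
      (Finset.single_le_sum (f := fun v => (G v).size) (fun _ _ => Nat.zero_le _)
        (Finset.mem_univ u)).trans hsizeAs
    have hdepthG : ∀ u, (G u).depth ≤ D - 1 := fun u => by
      have := hdp u
      omega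
    rcases Nat.lt_or_ge D 4 with hD4 | hD4
    · -- `D = 3`: the children are sparse leaves (or constants), `∂_mm P` is `s`-sparse and
      -- `Ψ_1 = Φ` (renamed) hits it
      have hD3' : D - 2 = 1 := by omega
      have hΨ1X : ∀ mm' : multilinearMonomials n, Ψ 1 (X mm') = rename Sum.inr (Φ mm') := by
        intro mm'
        rw [hΨ]
        simp only [aeval_X]
        rw [hstageGen]
        simp only
        rw [Finset.filter_false_of_mem, Finset.sum_empty, zero_add]
        intro ℓ _
        have := ℓ.2
        omega
      have hΨ1 : ∀ Q : MvPolynomial (multilinearMonomials n) F,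
          Ψ 1 Q = rename Sum.inr (bind₁ Φ Q) := by
        intro Q
        have h1 : Ψ 1 = aeval fun mm' : multilinearMonomials n => rename Sum.inr (Φ mm') := by
          refine MvPolynomial.algHom_ext fun mm' => ?_
          rw [hΨ1X, aeval_X]
        rw [h1, ← comp_aeval, AlgHom.comp_apply, aeval_eq_bind₁]
      have hΦ0 : bind₁ Φ (pderiv mm P) = 0 := by
        have h1 := hex
        rw [hΨ1] at h1
        exact rename_injective _ Sum.inr_injective (by rw [h1, map_zero])
      -- sparsity of `∂_mm P`
      have hleaf : ∀ u ∈ S, ((G u).eval).support.card ≤ (G u).size := by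
        intro u hu
        have hmu : mm ∈ (G u).eval.vars := (Finset.mem_filter.1 hu).2
        rcases OccurFormula.leaf_or_exists_eval_eq_C_of_depth_le_two (G u)
          (by have := hdp u; omega) with ⟨p, hp⟩ | ⟨c, hc⟩
        · rw [hp, OccurFormula.eval, OccurFormula.size]
          exact ASSS16.card_support_le_leafSize p
        · rw [hc, vars_C] at hmu
          exact absurd hmu (Finset.notMem_empty _)
      have hsuppd : (pderiv mm P).support.card ≤ s := by
        rw [hdsum]
        refine (card_support_sum_pderiv_le mm S fun u => (G u).eval).trans ?_
        refine (Finset.sum_le_sum hleaf).trans ?_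
        exact (Finset.sum_le_sum_of_subset_of_nonneg (Finset.filter_subset _ _)
          (fun _ _ _ => Nat.zero_le _)).trans hsizeAs
      exact hΦ (pderiv mm P) (hsuppd.trans hsR) hdP hΦ0
    · -- `D ≥ 4`: `Ψ_1` is faithful to the family `{∂_mm T_u : u ∈ S}` (INV(1)); the gradient of
      -- the gate is a LINEAR polynomial in that family
      let e : Fin S.card ≃ S := S.equivFin.symm
      set H : Fin S.card → OccurFormula F (multilinearMonomials n) := fun v => G (e v) with hH
      set T' : Fin S.card → multilinearMonomials n →₀ ℕ := fun _ => Finsupp.single mm 1 with hT'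
      have hk1' : S.card ≤ (asssRec k k 1).1 := by
        rw [ASSS16.asssRec_fst_succ, show (asssRec k k 0).1 = k from rfl]
        have hkk : k ≤ k * k ^ 2 := Nat.le_mul_of_pos_right k (pow_pos hk1 2)
        calc S.card ≤ k := hScard
          _ ≤ k * k ^ 2 := hkk
          _ ≤ (0 + 1) * 2 ^ (0 + 1) * k * k ^ 2 := by
              rw [show (0 + 1) * 2 ^ (0 + 1) * k * k ^ 2 = 2 * (k * k ^ 2) by ring]
              omega
      have hfaith := key (D - 4) 1 (by omega) le_rfl S.card H T' hk1' (fun v i => hoccG _ i)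
        (fun v => hsizeG _) (fun v => hdepthG _)
        (fun v => by rw [hT']; simp only [Finsupp.degree_single]; exact le_rfl)
      have hW : ∀ v, iterPderiv (A := F) (T' v) (H v).eval = pderiv mm (G (e v)).eval := by
        intro v
        rw [hT', hH]
        simp only [iterPderiv_single]
        rfl
      have hsumW : aeval (fun v => iterPderiv (A := F) (T' v) (H v).eval)
          (∑ v : Fin S.card, (X v : MvPolynomial (Fin S.card) F)) = pderiv mm P := by
        rw [map_sum]
        simp only [aeval_X, hW]
        rw [hdsum, ← Finset.sum_coe_sort S (fun u => pderiv mm (G u).eval)]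
        exact e.sum_comp (fun u : S => pderiv mm (G u).eval)
      have h1 := ASSS16.map_aeval_ne_zero_of_faithful (Ψ 1)
        (fun v => iterPderiv (A := F) (T' v) (H v).eval) (fun Q hQ => (hfaith Q).1 hQ)
        (∑ v : Fin S.card, (X v : MvPolynomial (Fin S.card) F)) (by rw [hsumW]; exact hdP)
      rw [hsumW] at h1
      exact h1 hex
  -- THE ROOT RECURSION (strong induction on the size of the formula)
  have main : ∀ (N : ℕ) (φ : OccurFormula F (multilinearMonomials n)), φ.size = N →
      φ.depth ≤ D → (∀ i, φ.occur i ≤ k) → φ.size ≤ s → φ.eval ≠ 0 → Ψ 0 φ.eval ≠ 0 := by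
    intro N
    induction N using Nat.strong_induction_on with
    | _ N ih =>
      intro φ hN hdepthφ hoccφ hsizeφ hne
      cases φ with
      | leaf p =>
        -- a leaf is `s`-sparse
        refine hsparse _ ?_ hne
        rw [OccurFormula.eval]
        rw [OccurFormula.size] at hsizeφ
        exact (ASSS16.card_support_le_leafSize p).trans hsizeφ
      | add as =>
        rw [OccurFormula.eval] at hne ⊢
        exact hadd as hdepthφ hoccφ hsizeφ hne
      | powProd ps =>
        -- a product of powers of non-zero children of smaller size
        obtain ⟨m, G, e, hev, hoccsum, hsz, hdp⟩ := OccurPowArgs.exists_fin_view ps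
        rw [OccurFormula.eval, hev] at hne ⊢
        rw [map_prod]
        refine Finset.prod_ne_zero_iff.2 fun u _ => ?_
        rw [map_pow]
        rcases Nat.eq_zero_or_pos (e u) with he0 | hepos
        · rw [he0, pow_zero]
          exact one_ne_zero
        refine pow_ne_zero _ ?_
        have hGu0 : (G u).eval ≠ 0 := fun h0 =>
          (Finset.prod_ne_zero_iff.1 hne u (Finset.mem_univ u)) (by rw [h0, zero_pow hepos.ne'])
        have hsizeps : ∑ i, (e i + (G i).size) = ps.size := hsz.symm
        have hsizePP : (OccurFormula.powProd ps).size = ps.size := by rw [OccurFormula.size]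
        have hlt : (G u).size < N := by
          have h1 : e u + (G u).size ≤ ∑ i, (e i + (G i).size) :=
            Finset.single_le_sum (f := fun i => e i + (G i).size) (fun _ _ => Nat.zero_le _)
              (Finset.mem_univ u)
          omega
        refine ih (G u).size hlt (G u) rfl ?_ ?_ ?_ hGu0
        · have h1 := hdepthφ
          rw [OccurFormula.depth] at h1
          have := hdp u
          omega
        · intro i
          have h1 := hoccφ i
          rw [OccurFormula.occur, hoccsum] at h1
          exact (Finset.single_le_sum (f := fun v => (G v).occur i) (fun _ _ => Nat.zero_le _)
            (Finset.mem_univ u)).trans h1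
        · have h1 : e u + (G u).size ≤ ∑ i, (e i + (G i).size) :=
            Finset.single_le_sum (f := fun i => e i + (G i).size) (fun _ _ => Nat.zero_le _)
              (Finset.mem_univ u)
          omega
  -- THE GENERATOR STATEMENT
  intro P hP hP0
  obtain ⟨φ, hφ, hdepthφ, hoccφ, hsizeφ⟩ := hP
  rw [hgen]
  show Ψ 0 P ≠ 0
  rw [← hφ] at hP0 ⊢
  exact main _ φ rfl hdepthφ hoccφ hsizeφ hP0

end Assembly

end Literature.Computability.AlgebraicComplexity

end
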